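import Mathlib
import HarnessLib
import HarnessLib.Audit
import Summits.HodgeConjecture.HodgeConjecture.Theorems.NikulinTwinTransportTwinSimilitudeAlgebraicTransfer
import Summits.HodgeConjecture.HodgeConjecture.Theorems.NikulinTwinTransportTwinSimilitudeAlgebraicLattice
import Literature.AlgebraicGeometry.HodgeTheory.AtiyahClassTraceReal
import Literature.AlgebraicGeometry.HodgeTheory.ChernCharacterBetti

/-!
# Line `semiregular-twin-hodge-locus` — crux `NikulinTwinTransport.TwinTwistorTransport` (stmt-HodgeConjecture-14522)

Skeleton of the ALGEBRAIC ROAD for the transport crux K2 of route `NikulinTwinTransport` (crux-plan,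
planner-cruxplan-stmt-HodgeConjecture-14522-semiregular-twin-hod-0, 2026-08-16), from the triaged crux idea
`Cruxes/TwinTwistorTransport/Ideas/semiregular-twin-hodge-locus.md` (3/3 pass) and the panel's sharpenings
(TRIAGE-r1-1 K3, TRIAGE-r1-2 §1 + `SemiregularityWindow.lean`, TRIAGE-r1-3 F-A/F-B/F-C + `TRIAGE-r1-3-Cert.lean`).

THE CRUX (informal, NO Lean declaration: item 14522 has `signature: null`). K2 = "(a) Verbitsky for the Ψ-matched
product + (b) chains of generic diagonal twistor lines + (c) GAGA endpoint": carry `m·graph(Ψ)` off the Nikulin anchor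
to every projective twin pair, where — "with HodgeIsometryAlgebraic (Buskin) this is X = TwinSimilitudeAlgebraic".
Its one consumer in the route is the typed TARGET X, and the tree PROVES that last implication:
`Theorems.NikulinTwinTransport.twinSimilitudeAlgebraic_of_twinTransport` (Buskin + three K3 facts + composition of
correspondences + `TwinTransportFor[M]` for ONE rational lattice `2`-similitude `M` ⟹ X). So the typed deliverable of
K1 + K2 is `∃ M N, Latt[M, N] ∧ TwinTransportFor[M]` (`twinTransport_of` below), and the skeleton is audited against
X BY NAME (`ledger skeleton check … --crux-decl Summit.HodgeConjecture.HodgeConjecture.Theses.NikulinTwinTransport.TwinSimilitudeAlgebraic`);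
the day the tenure planner types K2 as that statement, `twinTransport_of` is the crux proof skeleton verbatim.

THE LINE. Replace twistor transport by ALGEBRAIC DEFORMATION ALONG THE HODGE LOCUS (Bloch / Buchweitz–Flenner /
Pridham / Bandiera–Lepri–Manetti / Perry). Everything is phrased over MARKED projective K3 surfaces and their periods in
`Λ_ℂ = K3Index → ℂ` (the vocabulary of the Transfer theorem), never over families as schemes:
* `TwinAnchor` (research heart): in some Chern character theory `C` (`ChernCharacterBetti`) and for some rational
  lattice `2`-similitude `(M, N)`, every polarisation vector `h` (`h² > 0`) has an `h`-polarised marked `M`-twin anchor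
  pair carrying a finite locally free `{0,1}`-SEMIREGULAR `E` on `S × S'` (the tree's REAL `IsZeroOneSemiregular`:
  `(Tr, Tr(At∘·)) : Ext²(E,E) → H²(𝒪) ⊕ H³(Ω¹)` injective = BF's `{1,2}`-semiregularity) whose `ch₁` lies in the
  polarisation span and whose `ch₂` ACTS on `H²` as `m·(η⁻¹Mη') + c·(Nh.–)η⁻¹h`, `m ≠ 0` — i.e. `ch(E)` stays Hodge
  along the whole `h`-polarised twin family;
* `SemiregularTwinVHC` (BF Thm 5.1, read: arXiv math/9912245 §5, `I = {1,2}`, smooth germ = the `h`-polarised twin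
  Kuranishi germ `(B,0) ≅ (D_h, x₀)`): goodness on an open neighbourhood of the anchor period inside `D_h`;
* `TwinSpread` (universal quasi-polarised `M`-twin family over a level cover of `Γ'\D_h`, relative Hilbert schemes
  proper, Baire + irreducibility, strong Torelli at very general points; cf. Perry arXiv:2604.00511 Thm 1.1 (ii)):
  open ⟹ all of `D_h`;
* `PeriodInvariance` (Buskin re-marking, provable now): some good pair at period `x` ⟹ every marked `M`-twin pair at
  period `x` is good;
* `K3TransferFacts` (known): period surjectivity, markings, Hodge types of `H²(K3)`, composition of correspondences.
Composition `twinTransport_of` / `TwinTwistorTransport_of`: given a marked `M`-twin pair `(S,η,p,x; S',η',p',x')`, its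
`PeriodPt[x]` supplies a polarisation `h`; anchor for `h` ⟹ VHC-open set ⟹ spread to `x ∈ D_h` ⟹ re-mark ⟹
`TwinTransportFor[M]` ⟹ X by `twinSimilitudeAlgebraic_of_twinTransport` (route items `HodgeIsometryAlgebraic` r2 and
`LefschetzOneOneK3` enter as admissible named hypotheses, exactly the crux's `[deps: …, HodgeIsometryAlgebraic]`).

WINDOW (triage, honoured in the docstrings): `(σ₀, σ₁)` injective forces `ext²(E,E) ≤ 2 + c`, `c ∈ {20, 21}` the
codimension of the first-order Hodge locus of `(ch₁, ch₂)` (`c = 20` iff `ch₁ = 0 = c`), so the carrier is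
"diagonal-rigid" (toy `Ψ = id`, `𝒪_Δ`: `22 = 20 + 2`); rank-2 bundles and rank-0 carriers are numerically dead
(TRIAGE-r1-1 K3, r1-3 F-C), l.c.i. carriers need `h¹(N_Z) = 20`, `N = 0` (F-B) — the typed anchor is a finite locally
free `E` of ANY rank (the only carrier class with an honest semiregularity predicate in the tree today); complexes /
sheaves / l.c.i. / B-twisted (Perry) carriers are RESHAPE options recorded in the line card.

Disproof.lean (cdisprove gen-1/gen-2; evidence store not mounted in planner jails, read from the item's evidence
notes): its theorems concern the hyperkähler road (frame Schur, Nikulin parity F3, generic-line rigidity F2, rational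
first ray F4, polystable cross term F7, anchor cone F9) and are not engaged — this line uses no metric, no twistor line,
no stability; honoured: "Ψ rational, 2Ψ integral" (here `M` is the INTEGRAL lattice similitude of
`exists_twoSimilitude_k3Lattice`, `N` rational), `m` unconstrained (`m ≠ 0` in `ℂ`). None of the four landed
`Theorems/TwinTwistorTransport/Negative/*` lemmas (NikulinParity, GenericFirstLine, AnchorConeCondition,
PolystableCrossTerm) has an instance among the stubs.
-/

noncomputable section

namespace Summit.HodgeConjecture.HodgeConjecture.Cruxes.TwinTwistorTransport.SemiregularTwinHodgeLocus

open CategoryTheory MonoidalCategory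
open Literature.AlgebraicGeometry.Motives Literature.AlgebraicGeometry.HodgeTheory
open Literature.AlgebraicGeometry.Surfaces
open Literature.AlgebraicTopology.SingularHomology
open Summit.HodgeConjecture.HodgeConjecture.Theses.NikulinTwinTransport
open Summit.HodgeConjecture.HodgeConjecture.Theorems.NikulinTwinTransport

/-! ## Notation block A — verbatim from `Theorems/NikulinTwinTransportTwinSimilitudeAlgebraicTransfer` -/

local notation3 (prettyPrint := false) "MarkedK3[" S ", " η ", " p ", " x "]" =>
  (IsIntegralClass p ∧
    (∀ q : complexBetti S (2 * 2), IsIntegralClass q → ∃ n : ℤ, q = n • p) ∧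
    (∀ c : complexBetti S (2 * 1), IsIntegralClass c ↔ ∃ v : K3Index → ℤ, η c = fun i => (v i : ℂ)) ∧
    (∀ a b : complexBetti S (2 * 1),
        cupProduct (rfl : 2 * 1 + 2 * 1 = 2 * 2) a b = k3Form (η a) (η b) • p) ∧
    IsOfHodgeType 2 S (2 * 1) 2 0 (LinearEquiv.symm η x) ∧
    (∀ τ : complexBetti S (2 * 1), IsOfHodgeType 2 S (2 * 1) 2 0 τ → ∃ t : ℂ, τ = t • LinearEquiv.symm η x))

local notation3 (prettyPrint := false) "PeriodPt[" x "]" =>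
  (k3Form x x = 0 ∧ 0 < (k3Form (star x) x).re ∧
    ∃ u : K3Index → ℤ, k3Form (fun i => (u i : ℂ)) x = 0 ∧ 0 < ∑ i, ∑ j, u i * k3Gram i j * u j)

local notation3 (prettyPrint := false) "Corr[" μ ", " S ", " S' ", " hS ", " hS' " ; " γ ", " y "]" =>
  complexGysin μ
    (IsSmoothProjective.tensor_holds (IsK3Surface.isSmoothProjective hS)
      (IsK3Surface.isSmoothProjective hS'))
    (IsK3Surface.isSmoothProjective hS) (SemiCartesianMonoidalCategory.fst S S')
    (rfl : 2 * 1 + 2 * 2 + 2 * 2 = 2 * 1 + 2 * (2 + 2))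
    (cupProduct (rfl : 2 * 1 + 2 * 2 = 2 * 1 + 2 * 2)
      (complexBetti.map (SemiCartesianMonoidalCategory.snd S S') (2 * 1) y) γ)

local notation3 (prettyPrint := false) "TwinTransportFor[" M "]" =>
  ∀ (μ : OrientationFamily), μ.HasPoincareDuality →
    ∀ (S S' : SchemeOver ℂ) (hS : IsK3Surface S) (hS' : IsK3Surface S')
      (η : complexBetti S (2 * 1) ≃ₗ[ℂ] (K3Index → ℂ)) (p : complexBetti S (2 * 2))
      (x : K3Index → ℂ)
      (η' : complexBetti S' (2 * 1) ≃ₗ[ℂ] (K3Index → ℂ)) (p' : complexBetti S' (2 * 2))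
      (x' : K3Index → ℂ),
      MarkedK3[S, η, p, x] → PeriodPt[x] → MarkedK3[S', η', p', x'] → PeriodPt[x'] →
      (∃ t : ℂ, M x' = t • x) →
      ∃ γ ∈ algebraicClasses (MonoidalCategoryStruct.tensorObj S S') 2,
        ∀ y : complexBetti S' (2 * 1), η.symm (M (η' y)) = Corr[μ, S, S', hS, hS' ; γ, y]

/-! ## Notation block B — this line -/

/-- `Latt[M, N]`: `M` is a rational `2`-similitude of `(Λ_ℂ, k3Form)` with rational two-sided inverse `N`
(verbatim the conclusion of `exists_twoSimilitude_k3Lattice`). -/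
local notation3 (prettyPrint := false) "Latt[" M ", " N "]" =>
  ((∀ v : K3Index → ℤ, ∃ w : K3Index → ℚ, M (fun i => (v i : ℂ)) = fun i => (w i : ℂ)) ∧
    (∀ v : K3Index → ℤ, ∃ w : K3Index → ℚ, N (fun i => (v i : ℂ)) = fun i => (w i : ℂ)) ∧
    M * N = 1 ∧ N * M = 1 ∧
    (∀ a b, k3Form (M a) (M b) = 2 * k3Form a b))

/-- `PolPeriod[h, x]`: `x` is a period point polarised by the lattice vector `h` — `(x.x) = 0`,
`(x̄.x) > 0`, `(h.x) = 0` (the points of `D_h = D ∩ h^⊥`). -/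
local notation3 (prettyPrint := false) "PolPeriod[" h ", " x "]" =>
  (k3Form x x = 0 ∧ 0 < (k3Form (star x) x).re ∧ k3Form (fun i => ((h : K3Index → ℤ) i : ℂ)) x = 0)

/-- `Good[M, μ, S, S', hS, hS', η, η']`: the twin similitude `η⁻¹ ∘ M ∘ η'` is induced by an algebraic class. -/
local notation3 (prettyPrint := false) "Good[" M ", " μ ", " S ", " S' ", " hS ", " hS' ", " η ", " η' "]" =>
  ∃ γ ∈ algebraicClasses (MonoidalCategoryStruct.tensorObj S S') 2,
    ∀ y : complexBetti S' (2 * 1), (η : complexBetti S (2 * 1) ≃ₗ[ℂ] (K3Index → ℂ)).symm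
      (M ((η' : complexBetti S' (2 * 1) ≃ₗ[ℂ] (K3Index → ℂ)) y)) = Corr[μ, S, S', hS, hS' ; γ, y]

/-- `GoodPairAt[M, μ, x]`: SOME marked projective `M`-twin pair with first period `x` has an
algebraic twin similitude. -/
local notation3 (prettyPrint := false) "GoodPairAt[" M ", " μ ", " x "]" =>
  ∃ (S S' : SchemeOver ℂ) (hS : IsK3Surface S) (hS' : IsK3Surface S')
    (η : complexBetti S (2 * 1) ≃ₗ[ℂ] (K3Index → ℂ)) (p : complexBetti S (2 * 2))
    (η' : complexBetti S' (2 * 1) ≃ₗ[ℂ] (K3Index → ℂ)) (p' : complexBetti S' (2 * 2))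
    (x' : K3Index → ℂ),
    MarkedK3[S, η, p, x] ∧ PeriodPt[x] ∧ MarkedK3[S', η', p', x'] ∧ PeriodPt[x'] ∧
    (∃ t : ℂ, M x' = t • x) ∧ Good[M, μ, S, S', hS, hS', η, η']


/-- `AnchorData[C, M, N, μ, h ; S, S', hS, hS', η, p, x, η', p', x']`: an `h`-polarised marked `M`-twin ANCHOR pair
carrying a `{0,1}`-semiregular finite locally free carrier `E` on `S × S'` whose Chern character (in the Chern character
theory `C`) has the "everywhere-Hodge twin shape": `ch₁(E) ∈ ℂ·(h ⊗ 1) + ℂ·(1 ⊗ N h)` and `ch₂(E)` ACTS on `H²` as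
`m · (η⁻¹ ∘ M ∘ η') + c · (N h . –) η⁻¹ h` with `m ≠ 0` (pure Künneth parts act by zero; the scalar `c` absorbs the
orientation conventions of `μ`). -/
local notation3 (prettyPrint := false)
    "AnchorData[" C ", " M ", " N ", " μ ", " h " ; " S ", " S' ", " hS ", " hS' ", " η ", " p ", " x ", " η' ", " p' ", " x' "]" =>
  (MarkedK3[S, η, p, x] ∧ PolPeriod[h, x] ∧ MarkedK3[S', η', p', x'] ∧ PeriodPt[x'] ∧ (∃ t : ℂ, M x' = t • x) ∧
    ∃ (E : (MonoidalCategoryStruct.tensorObj S S').left.Modules) (hE : IsFiniteLocallyFree E),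
      IsZeroOneSemiregular hE ∧
      (∃ a b : ℂ, (C : ChernCharacterBetti).ch (MonoidalCategoryStruct.tensorObj S S') E 1 =
          a • complexBetti.map (SemiCartesianMonoidalCategory.fst S S') (2 * 1)
                ((η : complexBetti S (2 * 1) ≃ₗ[ℂ] (K3Index → ℂ)).symm (fun i => ((h : K3Index → ℤ) i : ℂ))) +
            b • complexBetti.map (SemiCartesianMonoidalCategory.snd S S') (2 * 1)
                ((η' : complexBetti S' (2 * 1) ≃ₗ[ℂ] (K3Index → ℂ)).symm
                  ((N : Module.End ℂ (K3Index → ℂ)) (fun i => ((h : K3Index → ℤ) i : ℂ))))) ∧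
      (∃ m c : ℂ, m ≠ 0 ∧ ∀ y : complexBetti S' (2 * 1),
          Corr[μ, S, S', hS, hS' ; (C : ChernCharacterBetti).ch (MonoidalCategoryStruct.tensorObj S S') E 2, y] =
            m • (η : complexBetti S (2 * 1) ≃ₗ[ℂ] (K3Index → ℂ)).symm ((M : Module.End ℂ (K3Index → ℂ)) (η' y)) +
              (c * k3Form ((N : Module.End ℂ (K3Index → ℂ)) (fun i => ((h : K3Index → ℤ) i : ℂ))) (η' y)) •
                (η : complexBetti S (2 * 1) ≃ₗ[ℂ] (K3Index → ℂ)).symm (fun i => ((h : K3Index → ℤ) i : ℂ))))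

/-- `CorrComp`: composition of algebraic correspondences between K3 surfaces is induced by an algebraic class
(verbatim the hypothesis `hcomp` of `twinSimilitudeAlgebraic_of_twinTransport`; Buskin Lemma 6.3 / Fulton Prop. 16.1.1). -/
local notation3 (prettyPrint := false) "CorrComp[]" =>
  ∀ (μ : OrientationFamily), μ.HasPoincareDuality →
    ∀ (S S' S'' : SchemeOver ℂ) (hS : IsK3Surface S) (hS' : IsK3Surface S') (hS'' : IsK3Surface S''),
    ∀ γ ∈ algebraicClasses (MonoidalCategoryStruct.tensorObj S S') 2,
    ∀ γ' ∈ algebraicClasses (MonoidalCategoryStruct.tensorObj S' S'') 2,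
    ∃ γ'' ∈ algebraicClasses (MonoidalCategoryStruct.tensorObj S S'') 2,
      ∀ y : complexBetti S'' (2 * 1),
        Corr[μ, S, S'', hS, hS'' ; γ'', y] = Corr[μ, S, S', hS, hS' ; γ, Corr[μ, S', S'', hS', hS'' ; γ', y]]

/-! ## The stub statements (precise `Prop`s; the sorried witnesses `Stub.<Name>` below are the REGISTERED stubs) -/

/-- **Stub 1 · TwinAnchor** (the research heart; open; hardest). In SOME Chern character theory `C` on `H²*(–(ℂ); ℂ)`
(hypothesis structure `ChernCharacterBetti`, intended instance the topological Chern character) and for SOME rational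
`2`-similitude `M` of the K3 lattice with rational inverse `N` (e.g. `exists_twoSimilitude_k3Lattice`), EVERY
polarisation vector `h ∈ Λ`, `h² > 0`, has an `h`-polarised marked projective `M`-twin anchor pair
`(S, η, p, x; S', η', p', x')` (`(h.x) = 0`, `M x' ∈ ℂ x`) carrying a finite locally free `{0,1}`-SEMIREGULAR `E` on
`S × S'` (`(σ₀, σ₁) = (Tr, Tr(At ∘ ·)) : Ext²(E,E) → H²(𝒪) ⊕ H³(Ω¹)` injective — Buchweitz–Flenner's `{1,2}`-semiregularity)
with `ch₁(E) ∈ ℂ(h ⊗ 1) + ℂ(1 ⊗ Nh)` and `[ch₂(E)]_* = m·(η⁻¹Mη') + c·(Nh.–)η⁻¹h` on `H²(S')`, `m ≠ 0`. -/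
def TwinAnchor : Prop :=
  ∃ (C : ChernCharacterBetti) (M N : Module.End ℂ (K3Index → ℂ)), Latt[M, N] ∧
    ∀ (μ : OrientationFamily), μ.HasPoincareDuality →
      ∀ (h : K3Index → ℤ), 0 < ∑ i, ∑ j, h i * k3Gram i j * h j →
        ∃ (S S' : SchemeOver ℂ) (hS : IsK3Surface S) (hS' : IsK3Surface S')
          (η : complexBetti S (2 * 1) ≃ₗ[ℂ] (K3Index → ℂ)) (p : complexBetti S (2 * 2)) (x : K3Index → ℂ)
          (η' : complexBetti S' (2 * 1) ≃ₗ[ℂ] (K3Index → ℂ)) (p' : complexBetti S' (2 * 2)) (x' : K3Index → ℂ),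
          AnchorData[C, M, N, μ, h ; S, S', hS, hS', η, p, x, η', p', x']

/-- **Stub 2 · SemiregularTwinVHC** (Buchweitz–Flenner Thm 5.1 on the `h`-polarised twin Kuranishi family; in print,
formal XL). For every Chern character theory `C`, lattice pair `(M, N)`, orientation family `μ` and polarisation `h`:
an anchor as in `TwinAnchor` at first period `x` makes the twin similitude algebraic on SOME marked `M`-twin pair at
every `h`-polarised period `z` of an open neighbourhood `U ∋ x` in `Λ_ℂ` — the deformation `W → (B, 0)` of
`W₀ = S × S'` over the `h`-polarised twin germ `B ≅ (D_h, x)` (local Torelli) has fibres `S_b × S'_b` that are marked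
`M`-twin pairs with periods filling `U ∩ D_h`; the flat transports of `ch₁(E)`, `ch₂(E)` stay of type `(1,1)`, `(2,2)`
on every fibre (their shape), so BF Thm 5.1 with `I = {1,2}` (= the tree's `{0,1}`) deforms `E` and makes
`ch₂(E)_b` ALGEBRAIC on `W_b` (fibres projective: GAGA + Chern classes of algebraic bundles are algebraic); subtracting
the divisor term `c·(h ⊗ Nh)` (Lefschetz (1,1) on both factors — antecedent `LefschetzOneOneK3` — and exterior
products of algebraic classes) and dividing by `m ≠ 0` gives `Good`. -/
def SemiregularTwinVHC : Prop :=
  ∀ (C : ChernCharacterBetti) (M N : Module.End ℂ (K3Index → ℂ)), Latt[M, N] →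
    ∀ (μ : OrientationFamily), μ.HasPoincareDuality →
      ∀ (h : K3Index → ℤ), 0 < ∑ i, ∑ j, h i * k3Gram i j * h j →
        LefschetzOneOneK3 →
        ∀ (S S' : SchemeOver ℂ) (hS : IsK3Surface S) (hS' : IsK3Surface S')
          (η : complexBetti S (2 * 1) ≃ₗ[ℂ] (K3Index → ℂ)) (p : complexBetti S (2 * 2)) (x : K3Index → ℂ)
          (η' : complexBetti S' (2 * 1) ≃ₗ[ℂ] (K3Index → ℂ)) (p' : complexBetti S' (2 * 2)) (x' : K3Index → ℂ),
          AnchorData[C, M, N, μ, h ; S, S', hS, hS', η, p, x, η', p', x'] →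
          ∃ U : Set (K3Index → ℂ), IsOpen U ∧ x ∈ U ∧ ∀ z ∈ U, PolPeriod[h, z] → GoodPairAt[M, μ, z]

/-- **Stub 3 · TwinSpread** (spreading over the `h`-polarised twin family; standard, formal XL). If the twin similitude
is algebraic on some marked `M`-twin pair at every `h`-polarised period of a non-empty open subset of `D_h`, then it is
so at EVERY `h`-polarised period: the universal quasi-polarised `M`-twin family over a level cover `B` of
`Γ'\D_h` (`Γ' = O(Λ) ∩ N⁻¹O(Λ)M⁻¹`-commensurable level, Baily–Borel: `B` smooth quasi-projective) has its
good-fibre locus a countable union of closed algebraic subsets (relative Hilbert schemes proper, classes flat on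
components); one containing an open set is a whole component (Baire + irreducibility), very general fibres transfer
`∃`-goodness to fibre-goodness by strong Torelli, and the conjugate component is reached by complex conjugation of
varieties. Antecedents: period surjectivity and markings (every polarised period is a fibre). -/
def TwinSpread : Prop :=
  ∀ (M N : Module.End ℂ (K3Index → ℂ)), Latt[M, N] →
    Huybrechts_K3_periodSurjective_projective → Huybrechts_K3_marking_exists →
    ∀ (μ : OrientationFamily), μ.HasPoincareDuality →
      ∀ (h : K3Index → ℤ), 0 < ∑ i, ∑ j, h i * k3Gram i j * h j →
        (∃ V : Set (K3Index → ℂ), IsOpen V ∧ (∃ z ∈ V, PolPeriod[h, z]) ∧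
            ∀ z ∈ V, PolPeriod[h, z] → GoodPairAt[M, μ, z]) →
        ∀ z : K3Index → ℂ, PolPeriod[h, z] → GoodPairAt[M, μ, z]

/-- **Stub 4 · PeriodInvariance** (re-marking by Buskin; provable now, size M). Goodness of ONE marked `M`-twin pair
with first period `x` passes to EVERY marked `M`-twin pair `(S, η, p, x₂; S', η', p', x')` with `x₂ ∈ ℂ x`:
`η⁻¹Mη' = (η⁻¹η₁) ∘ (η₁⁻¹Mη₁') ∘ (η₁'⁻¹η')`, the outer factors being rational Hodge ISOMETRIES between projective K3
surfaces with proportional periods (`isOfHodgeType_markingConj` with `ρ = 1`, granted `Huybrechts_K3_hodgeTypes_H2`),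
algebraic by Buskin (`HodgeIsometryAlgebraic`), composed by `CorrComp`. -/
def PeriodInvariance : Prop :=
  ∀ (M N : Module.End ℂ (K3Index → ℂ)), Latt[M, N] →
    ∀ (μ : OrientationFamily), μ.HasPoincareDuality →
      HodgeIsometryAlgebraic → Huybrechts_K3_hodgeTypes_H2 → CorrComp[] →
      ∀ (x : K3Index → ℂ), GoodPairAt[M, μ, x] →
        ∀ (S S' : SchemeOver ℂ) (hS : IsK3Surface S) (hS' : IsK3Surface S')
          (η : complexBetti S (2 * 1) ≃ₗ[ℂ] (K3Index → ℂ)) (p : complexBetti S (2 * 2)) (x₂ : K3Index → ℂ)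
          (η' : complexBetti S' (2 * 1) ≃ₗ[ℂ] (K3Index → ℂ)) (p' : complexBetti S' (2 * 2)) (x' : K3Index → ℂ),
          MarkedK3[S, η, p, x₂] → PeriodPt[x₂] → MarkedK3[S', η', p', x'] → PeriodPt[x'] →
          (∃ t : ℂ, M x' = t • x₂) → (∃ s : ℂ, x₂ = s • x) →
          Good[M, μ, S, S', hS, hS', η, η']

/-- **Stub 5 · K3TransferFacts** (known results; formal L–XL). The four inputs of the Buskin transfer
`twinSimilitudeAlgebraic_of_twinTransport` that are not route items: surjectivity of the period map (projective
form), existence of markings, the Hodge types of `H²(K3)` through the `(2,0)`-line (the tree's named facts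
`Huybrechts_K3_periodSurjective_projective`, `Huybrechts_K3_marking_exists`, `Huybrechts_K3_hodgeTypes_H2`;
Huybrechts, *Lectures on K3 Surfaces*, Ch. 1 Prop. 3.5, Ch. 3, Ch. 6 Prop. 1.2 / Thm. 3.1 and Ch. 7), and the
composition of algebraic correspondences between K3 surfaces (`CorrComp`, Fulton Prop. 16.1.1 on the tree's carriers:
Gysin base change for product squares + projection formula). -/
def K3TransferFacts : Prop :=
  Huybrechts_K3_periodSurjective_projective ∧ Huybrechts_K3_marking_exists ∧ Huybrechts_K3_hodgeTypes_H2 ∧ CorrComp[]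

/-! ## Sorry-free sanity lemmas (the lattice part of `TwinAnchor` is already in the tree; polarised periods are
projective period points) -/

/-- The `∃ M N, Latt[M, N]` part of `TwinAnchor` is discharged by the tree's explicit integral `2`-similitude
(`U(2) ⊂ U`, sum/difference on `E₈(−1)^{⊕2}`). -/
theorem latt_witness : ∃ M N : Module.End ℂ (K3Index → ℂ), Latt[M, N] :=
  exists_twoSimilitude_k3Lattice

/-- An `h`-polarised period point (`h² > 0`) is a projective period point in the sense of
`Huybrechts_K3_periodSurjective_projective` (witness `u = h`). -/
theorem periodPt_of_polPeriod {h : K3Index → ℤ} (hh : 0 < ∑ i, ∑ j, h i * k3Gram i j * h j)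
    {x : K3Index → ℂ} (hx : PolPeriod[h, x]) : PeriodPt[x] :=
  ⟨hx.1, hx.2.1, h, hx.2.2, hh⟩

/-! ## Registered stubs (sorried witnesses; `sorry` occurs nowhere else in this file) -/

namespace Stub

/-- Stub 1 (registered): see `TwinAnchor`. -/
theorem TwinAnchor : ∃ (C : ChernCharacterBetti) (M N : Module.End ℂ (K3Index → ℂ)), Latt[M, N] ∧
    ∀ (μ : OrientationFamily), μ.HasPoincareDuality →
      ∀ (h : K3Index → ℤ), 0 < ∑ i, ∑ j, h i * k3Gram i j * h j →
        ∃ (S S' : SchemeOver ℂ) (hS : IsK3Surface S) (hS' : IsK3Surface S')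
          (η : complexBetti S (2 * 1) ≃ₗ[ℂ] (K3Index → ℂ)) (p : complexBetti S (2 * 2)) (x : K3Index → ℂ)
          (η' : complexBetti S' (2 * 1) ≃ₗ[ℂ] (K3Index → ℂ)) (p' : complexBetti S' (2 * 2)) (x' : K3Index → ℂ),
          AnchorData[C, M, N, μ, h ; S, S', hS, hS', η, p, x, η', p', x'] := by
  sorry

/-- Stub 2 (registered): see `SemiregularTwinVHC`. -/
theorem SemiregularTwinVHC : ∀ (C : ChernCharacterBetti) (M N : Module.End ℂ (K3Index → ℂ)), Latt[M, N] →
    ∀ (μ : OrientationFamily), μ.HasPoincareDuality →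
      ∀ (h : K3Index → ℤ), 0 < ∑ i, ∑ j, h i * k3Gram i j * h j →
        LefschetzOneOneK3 →
        ∀ (S S' : SchemeOver ℂ) (hS : IsK3Surface S) (hS' : IsK3Surface S')
          (η : complexBetti S (2 * 1) ≃ₗ[ℂ] (K3Index → ℂ)) (p : complexBetti S (2 * 2)) (x : K3Index → ℂ)
          (η' : complexBetti S' (2 * 1) ≃ₗ[ℂ] (K3Index → ℂ)) (p' : complexBetti S' (2 * 2)) (x' : K3Index → ℂ),
          AnchorData[C, M, N, μ, h ; S, S', hS, hS', η, p, x, η', p', x'] →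
          ∃ U : Set (K3Index → ℂ), IsOpen U ∧ x ∈ U ∧ ∀ z ∈ U, PolPeriod[h, z] → GoodPairAt[M, μ, z] := by
  sorry

/-- Stub 3 (registered): see `TwinSpread`. -/
theorem TwinSpread : ∀ (M N : Module.End ℂ (K3Index → ℂ)), Latt[M, N] →
    Huybrechts_K3_periodSurjective_projective → Huybrechts_K3_marking_exists →
    ∀ (μ : OrientationFamily), μ.HasPoincareDuality →
      ∀ (h : K3Index → ℤ), 0 < ∑ i, ∑ j, h i * k3Gram i j * h j →
        (∃ V : Set (K3Index → ℂ), IsOpen V ∧ (∃ z ∈ V, PolPeriod[h, z]) ∧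
            ∀ z ∈ V, PolPeriod[h, z] → GoodPairAt[M, μ, z]) →
        ∀ z : K3Index → ℂ, PolPeriod[h, z] → GoodPairAt[M, μ, z] := by
  sorry

/-- Stub 4 (registered): see `PeriodInvariance`. -/
theorem PeriodInvariance : ∀ (M N : Module.End ℂ (K3Index → ℂ)), Latt[M, N] →
    ∀ (μ : OrientationFamily), μ.HasPoincareDuality →
      HodgeIsometryAlgebraic → Huybrechts_K3_hodgeTypes_H2 → CorrComp[] →
      ∀ (x : K3Index → ℂ), GoodPairAt[M, μ, x] →
        ∀ (S S' : SchemeOver ℂ) (hS : IsK3Surface S) (hS' : IsK3Surface S')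
          (η : complexBetti S (2 * 1) ≃ₗ[ℂ] (K3Index → ℂ)) (p : complexBetti S (2 * 2)) (x₂ : K3Index → ℂ)
          (η' : complexBetti S' (2 * 1) ≃ₗ[ℂ] (K3Index → ℂ)) (p' : complexBetti S' (2 * 2)) (x' : K3Index → ℂ),
          MarkedK3[S, η, p, x₂] → PeriodPt[x₂] → MarkedK3[S', η', p', x'] → PeriodPt[x'] →
          (∃ t : ℂ, M x' = t • x₂) → (∃ s : ℂ, x₂ = s • x) →
          Good[M, μ, S, S', hS, hS', η, η'] := by
  sorry

/-- Stub 5 (registered): see `K3TransferFacts`. -/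
theorem K3TransferFacts : Huybrechts_K3_periodSurjective_projective ∧ Huybrechts_K3_marking_exists ∧
    Huybrechts_K3_hodgeTypes_H2 ∧ CorrComp[] := by
  sorry

end Stub

/-! ## The composition (kernel-checked; no `sorry` below this line) -/

/-- **The typed output of K1 + K2 along the algebraic road**: the five stubs, Buskin's theorem
(`HodgeIsometryAlgebraic`, route item r2) and Lefschetz `(1,1)` for K3 surfaces (`LefschetzOneOneK3`, route support item)
give the TWIN TRANSPORT `TwinTransportFor[M]` for the lattice similitude `M` of the anchor — the statement the informal crux
`TwinTwistorTransport` (clauses (a)+(b)+(c)) exists to deliver. -/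
theorem twinTransport_of (hA : TwinAnchor) (hV : SemiregularTwinVHC) (hSp : TwinSpread) (hPI : PeriodInvariance)
    (hF : K3TransferFacts) (hB : HodgeIsometryAlgebraic) (hL : LefschetzOneOneK3) :
    ∃ (M N : Module.End ℂ (K3Index → ℂ)), Latt[M, N] ∧ TwinTransportFor[M] := by
  obtain ⟨C, M, N, hlatt, hanch⟩ := hA
  obtain ⟨hP, hM, hHT, hcomp⟩ := hF
  refine ⟨M, N, hlatt, ?_⟩
  intro μ hμ S S' hS hS' η p x η' p' x' hm hx hm' hx' hper
  obtain ⟨hxx, hxpos, h, hhx, hhpos⟩ := hx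
  -- the anchor for the polarisation `h` of `S`
  obtain ⟨S₀, S₀', hS₀, hS₀', η₀, p₀, x₀, η₀', p₀', x₀', hAD⟩ := hanch μ hμ h hhpos
  have hpol₀ : PolPeriod[h, x₀] := hAD.2.1
  -- Buchweitz–Flenner: goodness on an open neighbourhood of the anchor period inside `D_h`
  obtain ⟨U, hUo, hx₀U, hU⟩ := hV C M N hlatt μ hμ h hhpos hL S₀ S₀' hS₀ hS₀' η₀ p₀ x₀ η₀' p₀' x₀' hAD
  -- spreading over `D_h`
  have hall : ∀ z : K3Index → ℂ, PolPeriod[h, z] → GoodPairAt[M, μ, z] :=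
    hSp M N hlatt hP hM μ hμ h hhpos ⟨U, hUo, ⟨x₀, hx₀U, hpol₀⟩, hU⟩
  have hgood : GoodPairAt[M, μ, x] := hall x ⟨hxx, hxpos, hhx⟩
  -- re-marking
  exact hPI M N hlatt μ hμ hB hHT hcomp x hgood S S' hS hS' η p x η' p' x' hm
    (periodPt_of_polPeriod hhpos ⟨hxx, hxpos, hhx⟩) hm' hx' hper ⟨1, (one_smul ℂ x).symm⟩

/-- **`TwinTwistorTransport_of` — the line's composition, concluding the route's typed target
`TwinSimilitudeAlgebraic` BY NAME** (the informal crux `TwinTwistorTransport` has no Lean declaration; its only consumer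
in the route is X = `TwinSimilitudeAlgebraic` through Buskin's theorem, and that last step is the tree's PROVED
`twinSimilitudeAlgebraic_of_twinTransport`). Hypotheses: the five stubs, and the route items `HodgeIsometryAlgebraic`
(Buskin, r2) and `LefschetzOneOneK3` (support). -/
theorem TwinTwistorTransport_of (hA : TwinAnchor) (hV : SemiregularTwinVHC) (hSp : TwinSpread)
    (hPI : PeriodInvariance) (hF : K3TransferFacts) (hB : HodgeIsometryAlgebraic) (hL : LefschetzOneOneK3) :
    TwinSimilitudeAlgebraic := by
  obtain ⟨M, N, ⟨-, hNrat, hMN, -, hM2⟩, htw⟩ := twinTransport_of hA hV hSp hPI hF hB hL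
  obtain ⟨hP, hM, hHT, hcomp⟩ := hF
  exact twinSimilitudeAlgebraic_of_twinTransport hB hP hM hHT hcomp M N hNrat hMN hM2 htw

/-- The typed K1 + K2 output with the registered stubs plugged in (becomes the crux proof skeleton verbatim if
the tenure planner types `TwinTwistorTransport` as `∃ M N, Latt[M, N] ∧ TwinTransportFor[M]`). -/
theorem twinTransport_of_line (hB : HodgeIsometryAlgebraic) (hL : LefschetzOneOneK3) :
    ∃ (M N : Module.End ℂ (K3Index → ℂ)), Latt[M, N] ∧ TwinTransportFor[M] :=
  twinTransport_of Stub.TwinAnchor Stub.SemiregularTwinVHC Stub.TwinSpread Stub.PeriodInvariance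
    Stub.K3TransferFacts hB hL

/-- The skeleton with the registered stubs plugged in: modulo Buskin (`HodgeIsometryAlgebraic`) and Lefschetz `(1,1)`
(`LefschetzOneOneK3`) — both route items — the five stubs prove X. -/
theorem TwinSimilitudeAlgebraic_of_line (hB : HodgeIsometryAlgebraic) (hL : LefschetzOneOneK3) :
    TwinSimilitudeAlgebraic :=
  TwinTwistorTransport_of Stub.TwinAnchor Stub.SemiregularTwinVHC Stub.TwinSpread Stub.PeriodInvariance
    Stub.K3TransferFacts hB hL

end Summit.HodgeConjecture.HodgeConjecture.Cruxes.TwinTwistorTransport.SemiregularTwinHodgeLocus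

end
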